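import Mathlib
import Summits.ValiantsHypothesis.ValiantsHypothesis.Theorems.RigidityForcesSymmetryRankRigidMinimalReprLaplaceFiveAtMostTwoSlices
import Summits.ValiantsHypothesis.ValiantsHypothesis.Theorems.RigidityForcesSymmetryRankRigidMinimalReprLaplaceResidualCase1Leaf
import Summits.ValiantsHypothesis.ValiantsHypothesis.Theorems.RigidityForcesSymmetryRankRigidMinimalReprLaplaceResidualCase1HubsB
import Summits.ValiantsHypothesis.ValiantsHypothesis.Theorems.RigidityForcesSymmetryRankRigidMinimalReprLaplaceResidualCase1HubsC
import Summits.ValiantsHypothesis.ValiantsHypothesis.Theorems.RigidityForcesSymmetryRankRigidMinimalReprLaplaceResidualCase1HubsD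
import Summits.ValiantsHypothesis.ValiantsHypothesis.Theorems.RigidityForcesSymmetryRankRigidMinimalReprLaplaceResidualCase1HubsE

/-!
# `LaplaceOptimalFive`: in a cheap decomposition of `P₅` with three slices, every slice vector is a letter indicator
# (crux `RankRigidMinimalRepr`, stmt-ValiantsHypothesis-18034; frontier rung `LaplaceOptimalFive`, stmt-24813)

CASE 1 of the blueprint (evidence note NOTE-p8g11-24813 §v3) assembled: the twelve theorems
`triangle_case1{,_hub1,_hub2}`, `outside_case1{,_hub1,_hub2}`, `outside_leaf_case1{,_hub1,_hub2}`,
`outside_mid2_case1_hub{0,1,2}` (`…LaplaceResidualCase1*.lean`) refute each of the four residual configurations of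
`laplace_five_three_slices_residual` as soon as ONE of the three slice vectors admits an orthogonal covector with all five
coordinates non-zero — which is the case unless the vector is a non-zero multiple of a standard basis vector
(`exists_full_support_orthogonal`: a vector with two non-zero letters has such a covector).  Hence:

* `laplace_five_three_slices_residual_indicator` — OFFICIAL LaplaceOptimal 5 data, weight `< 120`, exactly three slice terms
  ⟹ the sorted labelled normal form is one of the four residual configurations AND each slice vector `α_k` has EXACTLY one
  non-zero letter (`∃ a, α_k a ≠ 0 ∧ ∀ c ≠ a, α_k c = 0`, i.e. the slice term is `κ·[v_k = a] · W_k`, `κ ≠ 0`).  What remains of «a cheap decomposition has at most two slices» is exactly CASE 2 of the blueprint.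

No definitions.  HONEST FRAMING: an exact partial result toward the frontier rung `LaplaceOptimalFive` (stmt-24813), which
stays OPEN; nothing here bears on `VP ≠ VNP`, which is NOT proved.
-/

set_option autoImplicit false

-- the mandated summit-side namespace repeats a component by design (single-problem summit)
set_option linter.dupNamespace false

namespace Summit.ValiantsHypothesis.ValiantsHypothesis.Theorems.RigidityForcesSymmetryRankRigidMinimalRepr

namespace LaplaceResidual

open Finset

/-- A vector with two non-zero letters admits an orthogonal covector with ALL coordinates non-zero. -/
theorem exists_full_support_orthogonal (α : Fin 5 → ℂ) (a b : Fin 5) (hab : a ≠ b) (ha : α a ≠ 0) (hb : α b ≠ 0) :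
    ∃ φ : Fin 5 → ℂ, (∀ c, φ c ≠ 0) ∧ ∑ c, φ c * α c = 0 := by
  classical
  -- the sum of the other coordinates
  set S : ℂ := ∑ c ∈ (univ.erase a).erase b, α c with hS
  -- choose `t ∈ {1, 2}` with `S + t α b ≠ 0`
  obtain ⟨t, ht0, ht⟩ : ∃ t : ℂ, t ≠ 0 ∧ S + t * α b ≠ 0 := by
    by_cases h : S + 1 * α b = 0
    · refine ⟨2, two_ne_zero, fun h' => hb ?_⟩
      linear_combination h' - h
    · exact ⟨1, one_ne_zero, h⟩
  refine ⟨fun c => if c = a then -(S + t * α b) / α a else if c = b then t else 1, fun c => ?_, ?_⟩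
  · by_cases hca : c = a
    · simp only [hca, if_true]
      exact div_ne_zero (neg_ne_zero.mpr ht) ha
    · by_cases hcb : c = b
      · simp only [hcb, hab.symm, if_false, if_true]; exact ht0
      · simp only [hca, hcb, if_false]; exact one_ne_zero
  · have hb' : b ∈ univ.erase a := mem_erase.mpr ⟨hab.symm, mem_univ b⟩
    rw [← add_sum_erase _ _ (mem_univ a), ← add_sum_erase _ _ hb']
    simp only [if_true, hab.symm, if_false]
    have hrest : ∑ x ∈ (univ.erase a).erase b, (if x = a then -(S + t * α b) / α a else if x = b then t else 1) * α x = S := by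
      rw [hS]
      refine sum_congr rfl fun x hx => ?_
      rw [mem_erase, mem_erase] at hx
      rw [if_neg hx.2.1, if_neg hx.1, one_mul]
    rw [hrest]
    field_simp
    ring

/-- **Residual configurations have letter-indicator slices.**  In the data format of `LaplaceOptimal 5`: if the terms sum
to the pattern with total Laplace weight `< 120` and exactly three of them are slices, then the sorted labelled normal form
is one of the four residual configurations and every slice vector has exactly one non-zero letter. -/
theorem laplace_five_three_slices_residual_indicator {N : ℕ} (T : Finset (Fin N)) (S : Fin N → Finset (Fin 5))
    (u w : Fin N → (Fin 5 → Fin 5) → ℂ)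
    (hu : ∀ t, ∀ v v' : Fin 5 → Fin 5, (∀ i ∈ S t, v i = v' i) → u t v = u t v')
    (hw : ∀ t, ∀ v v' : Fin 5 → Fin 5, (∀ i, i ∉ S t → v i = v' i) → w t v = w t v')
    (hsum : ∀ v : Fin 5 → Fin 5, (∑ t ∈ T, u t v * w t v) = if Function.Injective v then 1 else 0)
    (hlt : ∑ t ∈ T, (S t).card.factorial * (5 - (S t).card).factorial < 120)
    (h3 : (T.filter (fun t => (S t).card = 1 ∨ (S t).card = 4)).card = 3) :
    ∃ (c : Fin 3) (p0 q0 p1 q1 p2 q2 : Fin 5) (α : Fin 3 → Fin 5 → ℂ) (W : Fin 3 → (Fin 5 → Fin 5) → ℂ)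
      (u' w' : Fin 3 → (Fin 5 → Fin 5) → ℂ),
      (c, p0, q0, p1, q1, p2, q2) ∈ ([(0, 0, 1, 0, 2, 1, 2), (0, 0, 1, 0, 2, 3, 4), (0, 0, 1, 1, 2, 3, 4), (0, 0, 2, 1, 2, 3, 4)] :
        List (Fin 3 × Fin 5 × Fin 5 × Fin 5 × Fin 5 × Fin 5 × Fin 5)) ∧
      (∀ k, ∃ a : Fin 5, α k a ≠ 0 ∧ ∀ c', c' ≠ a → α k c' = 0) ∧
      (∀ k, ∀ v v' : Fin 5 → Fin 5,
        (∀ j, j ≠ (![![0, 1, 2], ![0, 0, 1], ![0, 0, 0]] : Fin 3 → Fin 3 → Fin 5) c k → v j = v' j) → W k v = W k v') ∧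
      (∀ t, ∀ v v' : Fin 5 → Fin 5, v ((![p0, p1, p2] : Fin 3 → Fin 5) t) = v' ((![p0, p1, p2] : Fin 3 → Fin 5) t) →
        v ((![q0, q1, q2] : Fin 3 → Fin 5) t) = v' ((![q0, q1, q2] : Fin 3 → Fin 5) t) → u' t v = u' t v') ∧
      (∀ t, ∀ v v' : Fin 5 → Fin 5, (∀ j, j ≠ (![p0, p1, p2] : Fin 3 → Fin 5) t →
        j ≠ (![q0, q1, q2] : Fin 3 → Fin 5) t → v j = v' j) → w' t v = w' t v') ∧
      ∀ v : Fin 5 → Fin 5, (if Function.Injective v then (1 : ℂ) else 0) =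
        (∑ k, α k (v ((![![0, 1, 2], ![0, 0, 1], ![0, 0, 0]] : Fin 3 → Fin 3 → Fin 5) c k)) * W k v) +
          ∑ t, u' t v * w' t v := by
  classical
  obtain ⟨c, p0, q0, p1, q1, p2, q2, α, W, u', w', hmem, hW, hu', hw', H⟩ :=
    LaplaceFiveSlices.laplace_five_three_slices_residual T S u w hu hw hsum hlt h3
  refine ⟨c, p0, q0, p1, q1, p2, q2, α, W, u', w', hmem, ?_, hW, hu', hw', H⟩
  by_contra hnot
  push Not at hnot
  obtain ⟨k, hk⟩ := hnot
  -- either `α k = 0` or it has two non-zero letters; in both cases a full-support orthogonal covector exists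
  have hfull : ∃ φ₀ : Fin 5 → ℂ, (∀ c, φ₀ c ≠ 0) ∧ ∑ c, φ₀ c * α k c = 0 := by
    by_cases hz : ∀ c, α k c = 0
    · exact ⟨fun _ => 1, fun _ => one_ne_zero, by simp [hz]⟩
    · push Not at hz
      obtain ⟨a, ha⟩ := hz
      obtain ⟨b, hba, hb⟩ := hk a ha
      exact exists_full_support_orthogonal (α k) a b (Ne.symm hba) ha hb
  -- the configuration
  simp only [List.mem_cons, Prod.mk.injEq, List.not_mem_nil, or_false] at hmem
  rcases hmem with ⟨rfl, rfl, rfl, rfl, rfl, rfl, rfl⟩ | ⟨rfl, rfl, rfl, rfl, rfl, rfl, rfl⟩ |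
    ⟨rfl, rfl, rfl, rfl, rfl, rfl, rfl⟩ | ⟨rfl, rfl, rfl, rfl, rfl, rfl, rfl⟩
  all_goals
    have hI : (![![0, 1, 2], ![0, 0, 1], ![0, 0, 0]] : Fin 3 → Fin 3 → Fin 5) 0 = (![0, 1, 2] : Fin 3 → Fin 5) := rfl
    simp only [hI] at hW H
  · fin_cases k
    · exact triangle_case1 α W hW u' w' hu' hw' hfull H
    · exact triangle_case1_hub1 α W hW u' w' hu' hw' hfull H
    · exact triangle_case1_hub2 α W hW u' w' hu' hw' hfull H
  · fin_cases k
    · exact outside_case1 α W hW u' w' hu' hw' hfull H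
    · exact outside_case1_hub1 α W hW u' w' hu' hw' hfull H
    · exact outside_case1_hub2 α W hW u' w' hu' hw' hfull H
  · fin_cases k
    · exact outside_leaf_case1 α W hW u' w' hu' hw' hfull H
    · exact outside_leaf_case1_hub1 α W hW u' w' hu' hw' hfull H
    · exact outside_leaf_case1_hub2 α W hW u' w' hu' hw' hfull H
  · fin_cases k
    · exact outside_mid2_case1_hub0 α W hW u' w' hu' hw' hfull H
    · exact outside_mid2_case1_hub1 α W hW u' w' hu' hw' hfull H
    · exact outside_mid2_case1_hub2 α W hW u' w' hu' hw' hfull H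

end LaplaceResidual

end Summit.ValiantsHypothesis.ValiantsHypothesis.Theorems.RigidityForcesSymmetryRankRigidMinimalRepr
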